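import Summits.BirchSwinnertonDyer.BirchSwinnertonDyer.Theorems.ManinLocalTwoThreeProductsOneThirtyTwoBH
import Summits.BirchSwinnertonDyer.BirchSwinnertonDyer.Theorems.ManinLocalTwoThreeBracketSturmProducts
import HarnessLib

/-!
# Level 132, class `132b` (weight 4): product certificates, part A

Cell `bsd-f2-manin`, route `ManinLocalTwoThree`, cruxes C2 `ManinOddAtFour` (stmt-BirchSwinnertonDyer-22967) / C3 `ManinPrimeToThreeAtNine` (stmt-22968); prover seat p2 gen 31;
`--supports` (helper).  WEIGHT-4 BRACKET–STURM for the class `132b` (optimal curve `132b1 = [0, -1, 0, -77, 330]`, `deg φ` too large for a weight-2 presentation):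
`x∘φ = A/B` with `A = Σ_p alphaB_p · C_{i_p}·C_{j_p}`, `B = Σ_p betaB_p · C_{i_p}·C_{j_p}` over `78` products of an's `30` basis `η`-quotients of `M₂(Γ₀(132))`
(exact linear algebra + LLL, seat p2 gen 31; the weight-`20` defect `216[A,B]² − F²(864A³ − 18c₄AB² − c₆B³)B` vanishes mod `q^482`, Sturm bound `480`).
HONEST FRAMING: kernel-checked identities of integer lists / elementary bookkeeping (standard axioms); nothing here proves C2/C3 for any `N`, Manin's conjecture or BSD.
[cite: Sturm1987, Thm. 1] [cite: AgasheRibetStein2006, §§1–2] [cite: Koehler2011, §2.1]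
-/

set_option autoImplicit false
-- lint-debt: the directory name repeats the summit name (sibling precedent `ManinLocalTwoThreeManinConstantEightyEight.lean`)
set_option linter.dupNamespace false

noncomputable section

open Complex
open UpperHalfPlane hiding I
open scoped MatrixGroups ModularForm
open ModularForm CongruenceSubgroup PowerSeries
open Literature.NumberTheory.ModularForms
open Literature.NumberTheory.EllipticCurves Literature.NumberTheory.EllipticCurves.ModularForms

namespace Summit.BirchSwinnertonDyer.BirchSwinnertonDyer.Theorems.ManinLocalTwoThree.LevelOneThirtyTwo

open Summit.BirchSwinnertonDyer.BirchSwinnertonDyer.Theorems.ManinLocalTwoThree.BracketSturm Summit.BirchSwinnertonDyer.BirchSwinnertonDyer.Theorems.ManinLocalTwoThree.PinningKernel Summit.BirchSwinnertonDyer.BirchSwinnertonDyer.Theorems.ManinLocalTwoThree.PinningOneThirtyTwo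
open Literature.NumberTheory.EllipticCurves.Rank1Residual.X11RankOneCertificates (discOf c4Of c6Of)

set_option maxHeartbeats 4000000
set_option maxRecDepth 16384

/-! ## Product certificates `0 … 12` -/

/-- `pTB 0 = tabsDeep 0 * tabsDeep 0` below `482` (kernel `decide`). [folklore] -/
theorem hpTB0 : mulList 482 (tabsDeep 0) (tabsDeep 0) = pTB 0 := by
  decide +kernel

/-- The table `pTB 0` agrees below `482` with the `q`-expansion of the weight-`4` form `C_0·C_0`. [folklore] -/
theorem hGB0 {C : Fin 30 → ModularForm (Gamma0 132) 2}
    (hi : ∀ n < 482, (((tabsDeep 0).getD n 0 : ℤ) : ℂ) = (qExpansion 1 ⇑(C 0)).coeff n)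
    (hj : ∀ n < 482, (((tabsDeep 0).getD n 0 : ℤ) : ℂ) = (qExpansion 1 ⇑(C 0)).coeff n) :
    ∀ n < 482, (((pTB 0).getD n 0 : ℤ) : ℂ) = (qExpansion 1 ⇑((C 0).mul (C 0))).coeff n := by
  rw [← hpTB0]; exact qExpansion_coeff_mul_eq_mulList (C 0) (C 0) hi hj

/-- `pTB 1 = tabsDeep 0 * tabsDeep 1` below `482` (kernel `decide`). [folklore] -/
theorem hpTB1 : mulList 482 (tabsDeep 0) (tabsDeep 1) = pTB 1 := by
  decide +kernel

/-- The table `pTB 1` agrees below `482` with the `q`-expansion of the weight-`4` form `C_0·C_1`. [folklore] -/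
theorem hGB1 {C : Fin 30 → ModularForm (Gamma0 132) 2}
    (hi : ∀ n < 482, (((tabsDeep 0).getD n 0 : ℤ) : ℂ) = (qExpansion 1 ⇑(C 0)).coeff n)
    (hj : ∀ n < 482, (((tabsDeep 1).getD n 0 : ℤ) : ℂ) = (qExpansion 1 ⇑(C 1)).coeff n) :
    ∀ n < 482, (((pTB 1).getD n 0 : ℤ) : ℂ) = (qExpansion 1 ⇑((C 0).mul (C 1))).coeff n := by
  rw [← hpTB1]; exact qExpansion_coeff_mul_eq_mulList (C 0) (C 1) hi hj

/-- `pTB 2 = tabsDeep 0 * tabsDeep 2` below `482` (kernel `decide`). [folklore] -/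
theorem hpTB2 : mulList 482 (tabsDeep 0) (tabsDeep 2) = pTB 2 := by
  decide +kernel

/-- The table `pTB 2` agrees below `482` with the `q`-expansion of the weight-`4` form `C_0·C_2`. [folklore] -/
theorem hGB2 {C : Fin 30 → ModularForm (Gamma0 132) 2}
    (hi : ∀ n < 482, (((tabsDeep 0).getD n 0 : ℤ) : ℂ) = (qExpansion 1 ⇑(C 0)).coeff n)
    (hj : ∀ n < 482, (((tabsDeep 2).getD n 0 : ℤ) : ℂ) = (qExpansion 1 ⇑(C 2)).coeff n) :
    ∀ n < 482, (((pTB 2).getD n 0 : ℤ) : ℂ) = (qExpansion 1 ⇑((C 0).mul (C 2))).coeff n := by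
  rw [← hpTB2]; exact qExpansion_coeff_mul_eq_mulList (C 0) (C 2) hi hj

/-- `pTB 3 = tabsDeep 0 * tabsDeep 3` below `482` (kernel `decide`). [folklore] -/
theorem hpTB3 : mulList 482 (tabsDeep 0) (tabsDeep 3) = pTB 3 := by
  decide +kernel

/-- The table `pTB 3` agrees below `482` with the `q`-expansion of the weight-`4` form `C_0·C_3`. [folklore] -/
theorem hGB3 {C : Fin 30 → ModularForm (Gamma0 132) 2}
    (hi : ∀ n < 482, (((tabsDeep 0).getD n 0 : ℤ) : ℂ) = (qExpansion 1 ⇑(C 0)).coeff n)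
    (hj : ∀ n < 482, (((tabsDeep 3).getD n 0 : ℤ) : ℂ) = (qExpansion 1 ⇑(C 3)).coeff n) :
    ∀ n < 482, (((pTB 3).getD n 0 : ℤ) : ℂ) = (qExpansion 1 ⇑((C 0).mul (C 3))).coeff n := by
  rw [← hpTB3]; exact qExpansion_coeff_mul_eq_mulList (C 0) (C 3) hi hj

/-- `pTB 4 = tabsDeep 0 * tabsDeep 4` below `482` (kernel `decide`). [folklore] -/
theorem hpTB4 : mulList 482 (tabsDeep 0) (tabsDeep 4) = pTB 4 := by
  decide +kernel

/-- The table `pTB 4` agrees below `482` with the `q`-expansion of the weight-`4` form `C_0·C_4`. [folklore] -/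
theorem hGB4 {C : Fin 30 → ModularForm (Gamma0 132) 2}
    (hi : ∀ n < 482, (((tabsDeep 0).getD n 0 : ℤ) : ℂ) = (qExpansion 1 ⇑(C 0)).coeff n)
    (hj : ∀ n < 482, (((tabsDeep 4).getD n 0 : ℤ) : ℂ) = (qExpansion 1 ⇑(C 4)).coeff n) :
    ∀ n < 482, (((pTB 4).getD n 0 : ℤ) : ℂ) = (qExpansion 1 ⇑((C 0).mul (C 4))).coeff n := by
  rw [← hpTB4]; exact qExpansion_coeff_mul_eq_mulList (C 0) (C 4) hi hj

/-- `pTB 5 = tabsDeep 0 * tabsDeep 5` below `482` (kernel `decide`). [folklore] -/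
theorem hpTB5 : mulList 482 (tabsDeep 0) (tabsDeep 5) = pTB 5 := by
  decide +kernel

/-- The table `pTB 5` agrees below `482` with the `q`-expansion of the weight-`4` form `C_0·C_5`. [folklore] -/
theorem hGB5 {C : Fin 30 → ModularForm (Gamma0 132) 2}
    (hi : ∀ n < 482, (((tabsDeep 0).getD n 0 : ℤ) : ℂ) = (qExpansion 1 ⇑(C 0)).coeff n)
    (hj : ∀ n < 482, (((tabsDeep 5).getD n 0 : ℤ) : ℂ) = (qExpansion 1 ⇑(C 5)).coeff n) :
    ∀ n < 482, (((pTB 5).getD n 0 : ℤ) : ℂ) = (qExpansion 1 ⇑((C 0).mul (C 5))).coeff n := by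
  rw [← hpTB5]; exact qExpansion_coeff_mul_eq_mulList (C 0) (C 5) hi hj

/-- `pTB 6 = tabsDeep 0 * tabsDeep 6` below `482` (kernel `decide`). [folklore] -/
theorem hpTB6 : mulList 482 (tabsDeep 0) (tabsDeep 6) = pTB 6 := by
  decide +kernel

/-- The table `pTB 6` agrees below `482` with the `q`-expansion of the weight-`4` form `C_0·C_6`. [folklore] -/
theorem hGB6 {C : Fin 30 → ModularForm (Gamma0 132) 2}
    (hi : ∀ n < 482, (((tabsDeep 0).getD n 0 : ℤ) : ℂ) = (qExpansion 1 ⇑(C 0)).coeff n)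
    (hj : ∀ n < 482, (((tabsDeep 6).getD n 0 : ℤ) : ℂ) = (qExpansion 1 ⇑(C 6)).coeff n) :
    ∀ n < 482, (((pTB 6).getD n 0 : ℤ) : ℂ) = (qExpansion 1 ⇑((C 0).mul (C 6))).coeff n := by
  rw [← hpTB6]; exact qExpansion_coeff_mul_eq_mulList (C 0) (C 6) hi hj

/-- `pTB 7 = tabsDeep 0 * tabsDeep 7` below `482` (kernel `decide`). [folklore] -/
theorem hpTB7 : mulList 482 (tabsDeep 0) (tabsDeep 7) = pTB 7 := by
  decide +kernel

/-- The table `pTB 7` agrees below `482` with the `q`-expansion of the weight-`4` form `C_0·C_7`. [folklore] -/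
theorem hGB7 {C : Fin 30 → ModularForm (Gamma0 132) 2}
    (hi : ∀ n < 482, (((tabsDeep 0).getD n 0 : ℤ) : ℂ) = (qExpansion 1 ⇑(C 0)).coeff n)
    (hj : ∀ n < 482, (((tabsDeep 7).getD n 0 : ℤ) : ℂ) = (qExpansion 1 ⇑(C 7)).coeff n) :
    ∀ n < 482, (((pTB 7).getD n 0 : ℤ) : ℂ) = (qExpansion 1 ⇑((C 0).mul (C 7))).coeff n := by
  rw [← hpTB7]; exact qExpansion_coeff_mul_eq_mulList (C 0) (C 7) hi hj

/-- `pTB 8 = tabsDeep 0 * tabsDeep 8` below `482` (kernel `decide`). [folklore] -/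
theorem hpTB8 : mulList 482 (tabsDeep 0) (tabsDeep 8) = pTB 8 := by
  decide +kernel

/-- The table `pTB 8` agrees below `482` with the `q`-expansion of the weight-`4` form `C_0·C_8`. [folklore] -/
theorem hGB8 {C : Fin 30 → ModularForm (Gamma0 132) 2}
    (hi : ∀ n < 482, (((tabsDeep 0).getD n 0 : ℤ) : ℂ) = (qExpansion 1 ⇑(C 0)).coeff n)
    (hj : ∀ n < 482, (((tabsDeep 8).getD n 0 : ℤ) : ℂ) = (qExpansion 1 ⇑(C 8)).coeff n) :
    ∀ n < 482, (((pTB 8).getD n 0 : ℤ) : ℂ) = (qExpansion 1 ⇑((C 0).mul (C 8))).coeff n := by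
  rw [← hpTB8]; exact qExpansion_coeff_mul_eq_mulList (C 0) (C 8) hi hj

/-- `pTB 9 = tabsDeep 0 * tabsDeep 9` below `482` (kernel `decide`). [folklore] -/
theorem hpTB9 : mulList 482 (tabsDeep 0) (tabsDeep 9) = pTB 9 := by
  decide +kernel

/-- The table `pTB 9` agrees below `482` with the `q`-expansion of the weight-`4` form `C_0·C_9`. [folklore] -/
theorem hGB9 {C : Fin 30 → ModularForm (Gamma0 132) 2}
    (hi : ∀ n < 482, (((tabsDeep 0).getD n 0 : ℤ) : ℂ) = (qExpansion 1 ⇑(C 0)).coeff n)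
    (hj : ∀ n < 482, (((tabsDeep 9).getD n 0 : ℤ) : ℂ) = (qExpansion 1 ⇑(C 9)).coeff n) :
    ∀ n < 482, (((pTB 9).getD n 0 : ℤ) : ℂ) = (qExpansion 1 ⇑((C 0).mul (C 9))).coeff n := by
  rw [← hpTB9]; exact qExpansion_coeff_mul_eq_mulList (C 0) (C 9) hi hj

/-- `pTB 10 = tabsDeep 0 * tabsDeep 10` below `482` (kernel `decide`). [folklore] -/
theorem hpTB10 : mulList 482 (tabsDeep 0) (tabsDeep 10) = pTB 10 := by
  decide +kernel

/-- The table `pTB 10` agrees below `482` with the `q`-expansion of the weight-`4` form `C_0·C_10`. [folklore] -/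
theorem hGB10 {C : Fin 30 → ModularForm (Gamma0 132) 2}
    (hi : ∀ n < 482, (((tabsDeep 0).getD n 0 : ℤ) : ℂ) = (qExpansion 1 ⇑(C 0)).coeff n)
    (hj : ∀ n < 482, (((tabsDeep 10).getD n 0 : ℤ) : ℂ) = (qExpansion 1 ⇑(C 10)).coeff n) :
    ∀ n < 482, (((pTB 10).getD n 0 : ℤ) : ℂ) = (qExpansion 1 ⇑((C 0).mul (C 10))).coeff n := by
  rw [← hpTB10]; exact qExpansion_coeff_mul_eq_mulList (C 0) (C 10) hi hj

/-- `pTB 11 = tabsDeep 0 * tabsDeep 11` below `482` (kernel `decide`). [folklore] -/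
theorem hpTB11 : mulList 482 (tabsDeep 0) (tabsDeep 11) = pTB 11 := by
  decide +kernel

/-- The table `pTB 11` agrees below `482` with the `q`-expansion of the weight-`4` form `C_0·C_11`. [folklore] -/
theorem hGB11 {C : Fin 30 → ModularForm (Gamma0 132) 2}
    (hi : ∀ n < 482, (((tabsDeep 0).getD n 0 : ℤ) : ℂ) = (qExpansion 1 ⇑(C 0)).coeff n)
    (hj : ∀ n < 482, (((tabsDeep 11).getD n 0 : ℤ) : ℂ) = (qExpansion 1 ⇑(C 11)).coeff n) :
    ∀ n < 482, (((pTB 11).getD n 0 : ℤ) : ℂ) = (qExpansion 1 ⇑((C 0).mul (C 11))).coeff n := by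
  rw [← hpTB11]; exact qExpansion_coeff_mul_eq_mulList (C 0) (C 11) hi hj

/-- `pTB 12 = tabsDeep 0 * tabsDeep 12` below `482` (kernel `decide`). [folklore] -/
theorem hpTB12 : mulList 482 (tabsDeep 0) (tabsDeep 12) = pTB 12 := by
  decide +kernel

/-- The table `pTB 12` agrees below `482` with the `q`-expansion of the weight-`4` form `C_0·C_12`. [folklore] -/
theorem hGB12 {C : Fin 30 → ModularForm (Gamma0 132) 2}
    (hi : ∀ n < 482, (((tabsDeep 0).getD n 0 : ℤ) : ℂ) = (qExpansion 1 ⇑(C 0)).coeff n)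
    (hj : ∀ n < 482, (((tabsDeep 12).getD n 0 : ℤ) : ℂ) = (qExpansion 1 ⇑(C 12)).coeff n) :
    ∀ n < 482, (((pTB 12).getD n 0 : ℤ) : ℂ) = (qExpansion 1 ⇑((C 0).mul (C 12))).coeff n := by
  rw [← hpTB12]; exact qExpansion_coeff_mul_eq_mulList (C 0) (C 12) hi hj


end Summit.BirchSwinnertonDyer.BirchSwinnertonDyer.Theorems.ManinLocalTwoThree.LevelOneThirtyTwo

end
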